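import Literature.Analysis.FluidPDE.ParabolicHeatPotentials
import Literature.Analysis.UnboundedOperators.HeatKernelBoundedData
import HarnessLib

/-!
# Jia–Šverák 2014, proof of Thm. 3.2: the caloric extension of Hölder data is parabolic-Hölder

Analysis/FluidPDE proofs file (theorems only, no new definitions, no new named facts), part of
the proof of the named fact `Literature.Analysis.FluidPDE.jia_sverak_2014_theorem_3_2`
(`JiaSverak2014LocalRegularity.lean`; H. Jia, V. Šverák, Invent. Math. 196 (2014) =
arXiv:1204.0529, §3 Thm. 3.2). In the printed proof (arXiv p. 9) the localised datum is flowed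
by the heat semigroup, `u₂(·,t) = e^{Δt}(u₀η)`, and "by Lemma 2.1 we see `u₁` and `u₂` are Hölder
continuous"; for `u₂` this is the classical fact that the caloric extension of a bounded,
uniformly `C^β` datum is Hölderian of exponent `β` for the parabolic distance, up to `t = 0`,
with the datum as trace. This file proves it, with constants, from the tree's mollification
estimates for the Gauss–Weierstrass kernel (`HeatKernelBoundedData.lean`):

* `norm_heatExtension_sub_heatExtension_le_of_holder` — `[e^{tΔ}g]_β ≤ [g]_β` (translation
  invariance);
* `norm_heatExtension_sub_heatExtension_time_le_of_holder` —
  `|e^{tΔ}g(x) - e^{sΔ}g(x)| ≤ (1 + 2·2^{3/2}) [g]_β |t - s|^{β/2}` (semigroup law and the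
  mollification error `|e^{τΔ}h - h| ≤ (1 + 2·2^{3/2})[h]_β τ^{β/2}`);
* `caloric_parabolicHolderOnWith` — the function equal to `e^{tΔ}g(x)` for `t > 0` and to `g(x)`
  for `t ≤ 0` is `ParabolicHolderOnWith ((2 + 2·2^{3/2})[g]_β) β` on `[0,∞) × ℝ³`;
* `holder_cutoff_smul` — a datum Hölderian and bounded on `B₂(x₀)` times a Lipschitz cut-off
  supported in `B₁(x₀)` is uniformly Hölderian on `ℝ³` (the localisation `u₀η` of the print).

## References

* H. Jia, V. Šverák, Invent. Math. 196 (2014) = arXiv:1204.0529, §2 Lemma 2.1, §3 proof of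
  Thm. 3.2 (p. 9). Bib key `JiaSverak2014`.
* T. Buckmaster, C. De Lellis, L. Székelyhidi Jr., V. Vicol, CPAM 72 (2019), §2.2 (standard
  mollification estimates). Bib key `BuckmasterEtAl2018`.
-/

noncomputable section

open MeasureTheory TopologicalSpace Set Function Filter Metric
open _root_.Topology
open scoped ENNReal NNReal

namespace Literature.Analysis.FluidPDE

namespace JiaSverak2014

open Literature.Analysis.UnboundedOperators

variable {F : Type*} [NormedAddCommGroup F] [NormedSpace ℝ F] [CompleteSpace F]

/-! ### Sup bound and spatial Hölder bound of the caloric extension -/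

omit [CompleteSpace F] in
/-- **`[e^{tΔ}g]_β ≤ [g]_β`**: the caloric extension of uniformly Hölderian bounded continuous data
is uniformly Hölderian in space with the same constant (translation invariance of the kernel).
[folklore] -/
theorem norm_heatExtension_sub_heatExtension_le_of_holder {g : (EuclideanSpace ℝ (Fin 3)) → F} (hg : Continuous g)
    {C : ℝ} (hC : ∀ z, ‖g z‖ ≤ C) {A β : ℝ} (hH : ∀ y z, ‖g y - g z‖ ≤ A * ‖y - z‖ ^ β)
    {t : ℝ} (ht : 0 < t) (x x' : EuclideanSpace ℝ (Fin 3)) :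
    ‖heatExtension g t x - heatExtension g t x'‖ ≤ A * ‖x - x'‖ ^ β := by
  rw [heatExtension_apply, heatExtension_apply,
    ← integral_sub (integrable_heatKernel_smul_of_bound hg hC ht x) (integrable_heatKernel_smul_of_bound hg hC ht x')]
  have hA : 0 ≤ A * ‖x - x'‖ ^ β := by
    have h := hH x x'
    exact (norm_nonneg _).trans h
  calc ‖∫ y, (heatKernel t y • g (x - y) - heatKernel t y • g (x' - y))‖
      ≤ ∫ y, heatKernel t y * (A * ‖x - x'‖ ^ β) := by
        refine norm_integral_le_of_norm_le ((integrable_heatKernel_holds ht).mul_const _)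
          (Eventually.of_forall fun y => ?_)
        rw [← smul_sub, norm_smul, Real.norm_of_nonneg (heatKernel_pos ht y).le]
        refine mul_le_mul_of_nonneg_left ?_ (heatKernel_pos ht y).le
        have h := hH (x - y) (x' - y)
        rwa [show x - y - (x' - y) = x - x' by abel] at h
    _ = A * ‖x - x'‖ ^ β := by rw [integral_mul_const, integral_heatKernel_eq_one_holds ht, one_mul]

/-- **Time increments**: `|e^{tΔ}g(x) - e^{sΔ}g(x)| ≤ (1 + 2·2^{3/2}) [g]_β (t - s)^{β/2}` for
`0 < s < t` (semigroup law `e^{tΔ} = e^{(t-s)Δ}e^{sΔ}` and the mollification error for the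
Hölderian slice `e^{sΔ}g`). [folklore] -/
theorem norm_heatExtension_sub_heatExtension_time_le_of_holder {g : (EuclideanSpace ℝ (Fin 3)) → F}
    (hg : Continuous g) {C : ℝ} (hC : ∀ z, ‖g z‖ ≤ C) {A β : ℝ} (hA : 0 ≤ A) (hβ0 : 0 ≤ β) (hβ1 : β ≤ 1)
    (hH : ∀ y z, ‖g y - g z‖ ≤ A * ‖y - z‖ ^ β) {s t : ℝ} (hs : 0 < s) (hst : s < t) (x : EuclideanSpace ℝ (Fin 3)) :
    ‖heatExtension g t x - heatExtension g s x‖ ≤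
      (1 + 2 * (2 : ℝ) ^ ((3 : ℝ) / 2)) * A * (t - s) ^ (β / 2) := by
  have hmem : MemLp g ∞ (volume : Measure (EuclideanSpace ℝ (Fin 3))) := memLp_top_of_continuous_of_bound hg hC
  have hts : 0 < t - s := by linarith
  have hsemi : heatExtension g t = heatExtension (heatExtension g s) (t - s) := by
    rw [heatExtension_add_holds hmem le_top hs hts]
    congr 1; ring
  rw [hsemi]
  have hgs : Continuous (heatExtension g s) := (contDiff_heatExtension_of_bound hg hC hs (m := 0)).continuous
  have hCs : ∀ z, ‖heatExtension g s z‖ ≤ C := fun z => norm_heatExtension_le hC hs z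
  have hHs : ∀ y z, ‖heatExtension g s y - heatExtension g s z‖ ≤ A * ‖y - z‖ ^ β := fun y z =>
    norm_heatExtension_sub_heatExtension_le_of_holder hg hC hH hs y z
  have h := norm_heatExtension_sub_self_le_of_holder hgs hCs hA hβ0 hβ1 hHs hts x
  rw [finrank_euclideanSpace_fin] at h
  exact_mod_cast h

/-! ### Parabolic Hölder continuity up to `t = 0` -/

/-- Elementary: `a ≤ (a + b)` powers, `a^β ≤ (a + b)^β` for `0 ≤ a, b`, `0 ≤ β`. [folklore] -/
private theorem rpow_le_rpow_add_left {a b β : ℝ} (ha : 0 ≤ a) (hb : 0 ≤ b) (hβ : 0 ≤ β) :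
    a ^ β ≤ (a + b) ^ β :=
  Real.rpow_le_rpow ha (le_add_of_nonneg_right hb) hβ

/-- **The caloric extension of Hölder data is parabolic-Hölder up to the initial time**
(Jia–Šverák 2014, proof of Thm. 3.2, the term `u₂ = e^{Δt}(u₀η)`, via their Lemma 2.1; here the
classical statement with constants). Let `g : ℝ³ → F` be continuous, bounded, and uniformly
Hölderian, `‖g y - g z‖ ≤ A‖y - z‖^β` with `0 ≤ β ≤ 1`. Then the function `V` equal to
`e^{tΔ}g(x)` for `t > 0` and to `g(x)` for `t ≤ 0` satisfies
`‖V(z₁) - V(z₂)‖ ≤ (2 + 2·2^{3/2}) A (|t₁ - t₂|^{1/2} + ‖x₁ - x₂‖)^β` on `[0, ∞) × ℝ³`.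
[cite: JiaSverak2014, §2 Lemma 2.1 and §3 proof of Thm. 3.2 (arXiv p. 9)] -/
theorem caloric_parabolicHolderOnWith {g : (EuclideanSpace ℝ (Fin 3)) → F} (hg : Continuous g) {C : ℝ}
    (hC : ∀ z, ‖g z‖ ≤ C) {A β : ℝ} (hA : 0 ≤ A) (hβ0 : 0 ≤ β) (hβ1 : β ≤ 1)
    (hH : ∀ y z, ‖g y - g z‖ ≤ A * ‖y - z‖ ^ β) :
    ParabolicHolderOnWith ((2 + 2 * (2 : ℝ) ^ ((3 : ℝ) / 2)) * A) β
      (fun z : ℝ × EuclideanSpace ℝ (Fin 3) => if 0 < z.1 then heatExtension g z.1 z.2 else g z.2)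
      (Ici (0 : ℝ) ×ˢ (univ : Set (EuclideanSpace ℝ (Fin 3)))) := by
  set cn : ℝ := 1 + 2 * (2 : ℝ) ^ ((3 : ℝ) / 2) with hcn
  have hcn1 : 1 ≤ cn := by
    have : 0 ≤ 2 * (2 : ℝ) ^ ((3 : ℝ) / 2) := by positivity
    rw [hcn]; linarith
  set V : ℝ × EuclideanSpace ℝ (Fin 3) → F := fun z => if 0 < z.1 then heatExtension g z.1 z.2 else g z.2 with hV
  -- slices of `V` are Hölderian with constant `A` and bounded by `C`
  have hVx : ∀ (t : ℝ) (x x' : EuclideanSpace ℝ (Fin 3)), ‖V (t, x) - V (t, x')‖ ≤ A * ‖x - x'‖ ^ β := by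
    intro t x x'
    by_cases ht : 0 < t
    · simp only [hV, ht, if_true]
      exact norm_heatExtension_sub_heatExtension_le_of_holder hg hC hH ht x x'
    · simp only [hV, ht, if_false]
      exact hH x x'
  -- time increments at a fixed point: `‖V(t,x) - V(s,x)‖ ≤ cn A |t - s|^{β/2}` for `0 ≤ s ≤ t`
  have hVt : ∀ (s t : ℝ) (x : EuclideanSpace ℝ (Fin 3)), 0 ≤ s → s ≤ t →
      ‖V (t, x) - V (s, x)‖ ≤ cn * A * (t - s) ^ (β / 2) := by
    intro s t x hs hst
    rcases eq_or_lt_of_le hst with rfl | hlt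
    · simp only [sub_self, norm_zero]
      positivity
    by_cases hs0 : 0 < s
    · have ht0 : 0 < t := hs0.trans hlt
      simp only [hV, hs0, ht0, if_true]
      exact norm_heatExtension_sub_heatExtension_time_le_of_holder hg hC hA hβ0 hβ1 hH hs0 hlt x
    · have hs' : s = 0 := le_antisymm (not_lt.1 hs0) hs
      subst hs'
      have ht0 : 0 < t := hlt
      simp only [hV, ht0, lt_irrefl, if_true, if_false, sub_zero]
      have h := norm_heatExtension_sub_self_le_of_holder hg hC hA hβ0 hβ1 hH ht0 x
      rw [finrank_euclideanSpace_fin] at h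
      exact_mod_cast h
  -- the two-point estimate
  rintro ⟨t₁, x₁⟩ ⟨ht₁, -⟩ ⟨t₂, x₂⟩ ⟨ht₂, -⟩
  rw [mem_Ici] at ht₁ ht₂
  have hd := parabolicDist_nonneg ((t₁, x₁) : ℝ × EuclideanSpace ℝ (Fin 3)) (t₂, x₂)
  have hdx : ‖x₁ - x₂‖ ^ β ≤ parabolicDist ((t₁, x₁) : ℝ × EuclideanSpace ℝ (Fin 3)) (t₂, x₂) ^ β := by
    unfold parabolicDist
    rw [add_comm]
    exact rpow_le_rpow_add_left (norm_nonneg _) (Real.sqrt_nonneg _) hβ0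
  have hdt : |t₁ - t₂| ^ (β / 2) ≤ parabolicDist ((t₁, x₁) : ℝ × EuclideanSpace ℝ (Fin 3)) (t₂, x₂) ^ β := by
    unfold parabolicDist
    have e : |t₁ - t₂| ^ (β / 2) = (Real.sqrt |t₁ - t₂|) ^ β := by
      rw [Real.sqrt_eq_rpow, ← Real.rpow_mul (abs_nonneg _)]
      congr 1; ring
    rw [e]
    exact rpow_le_rpow_add_left (Real.sqrt_nonneg _) (norm_nonneg _) hβ0
  -- time part, symmetric in the two points
  have htime : ‖V (t₁, x₂) - V (t₂, x₂)‖ ≤ cn * A * |t₁ - t₂| ^ (β / 2) := by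
    rcases le_total t₂ t₁ with h | h
    · rw [abs_of_nonneg (sub_nonneg.2 h)]
      exact hVt t₂ t₁ x₂ ht₂ h
    · rw [norm_sub_rev, abs_sub_comm, abs_of_nonneg (sub_nonneg.2 h)]
      exact hVt t₁ t₂ x₂ ht₁ h
  calc ‖V (t₁, x₁) - V (t₂, x₂)‖
      ≤ ‖V (t₁, x₁) - V (t₁, x₂)‖ + ‖V (t₁, x₂) - V (t₂, x₂)‖ := norm_sub_le_norm_sub_add_norm_sub _ _ _
    _ ≤ A * ‖x₁ - x₂‖ ^ β + cn * A * |t₁ - t₂| ^ (β / 2) := add_le_add (hVx t₁ x₁ x₂) htime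
    _ ≤ A * parabolicDist ((t₁, x₁) : ℝ × EuclideanSpace ℝ (Fin 3)) (t₂, x₂) ^ β +
          cn * A * parabolicDist ((t₁, x₁) : ℝ × EuclideanSpace ℝ (Fin 3)) (t₂, x₂) ^ β := by
        gcongr
    _ = (1 + cn) * A * parabolicDist ((t₁, x₁) : ℝ × EuclideanSpace ℝ (Fin 3)) (t₂, x₂) ^ β := by ring
    _ = (2 + 2 * (2 : ℝ) ^ ((3 : ℝ) / 2)) * A * parabolicDist ((t₁, x₁) : ℝ × EuclideanSpace ℝ (Fin 3)) (t₂, x₂) ^ β := by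
        rw [hcn]; ring

omit [CompleteSpace F] in
/-- The caloric function of `caloric_parabolicHolderOnWith` is bounded by `sup |g|`. [folklore] -/
theorem norm_caloric_le_of_bound {g : (EuclideanSpace ℝ (Fin 3)) → F} {C : ℝ}
    (hC : ∀ z, ‖g z‖ ≤ C) (z : ℝ × EuclideanSpace ℝ (Fin 3)) :
    ‖(if 0 < z.1 then heatExtension g z.1 z.2 else g z.2)‖ ≤ C := by
  by_cases hz : 0 < z.1
  · rw [if_pos hz]; exact norm_heatExtension_le hC hz z.2
  · rw [if_neg hz]; exact hC _

/-! ### Localised Hölder data -/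

/-- **Localising Hölder data**: if `u₀` is bounded by `M` and `(M, γ)`-Hölderian on `B₂(x₀)`
(`0 < γ ≤ 1`), and `χ` is a cut-off with `|χ| ≤ 1`, `|χ(x) - χ(y)| ≤ L‖x - y‖`, vanishing off
`B₁(x₀)`, then `χu₀` is uniformly Hölderian on `ℝ³`:
`‖χ(y)u₀(y) - χ(z)u₀(z)‖ ≤ M(1 + 4L)‖y - z‖^γ` (and bounded by `M`, continuous). The
localisation `u₀η` of the printed proof. [cite: JiaSverak2014, §3 proof of Thm. 3.2 (arXiv p. 9)] -/
theorem holder_cutoff_smul {u₀ : (EuclideanSpace ℝ (Fin 3)) → (EuclideanSpace ℝ (Fin 3))} {χ : (EuclideanSpace ℝ (Fin 3)) → ℝ}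
    {x₀ : EuclideanSpace ℝ (Fin 3)} {M L γ : ℝ} (hM0 : 0 ≤ M) (hL0 : 0 ≤ L) (hγ0 : 0 < γ) (hγ1 : γ ≤ 1)
    (hM : ∀ x ∈ ball x₀ 2, ‖u₀ x‖ ≤ M)
    (hH : ∀ x ∈ ball x₀ 2, ∀ y ∈ ball x₀ 2, ‖u₀ x - u₀ y‖ ≤ M * ‖x - y‖ ^ γ)
    (hχ1 : ∀ x, |χ x| ≤ 1) (hχL : ∀ x y, |χ x - χ y| ≤ L * ‖x - y‖)
    (hχs : ∀ x, x ∉ ball x₀ 1 → χ x = 0) (y z : EuclideanSpace ℝ (Fin 3)) :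
    ‖χ y • u₀ y - χ z • u₀ z‖ ≤ M * (1 + 4 * L) * ‖y - z‖ ^ γ := by
  -- the one-sided case: `y` outside `B₂(x₀)`
  have hout : ∀ y z : EuclideanSpace ℝ (Fin 3), y ∉ ball x₀ 2 →
      ‖χ y • u₀ y - χ z • u₀ z‖ ≤ M * (1 + 4 * L) * ‖y - z‖ ^ γ := by
    intro y z hy
    rw [hχs y fun h => hy (ball_subset_ball (by norm_num) h), zero_smul, zero_sub, norm_neg]
    by_cases hz : z ∈ ball x₀ 1
    · have hyz : 1 ≤ ‖y - z‖ := by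
        rw [mem_ball, dist_eq_norm] at hz
        rw [mem_ball, dist_eq_norm, not_lt] at hy
        have := norm_sub_le_norm_sub_add_norm_sub y z x₀
        linarith
      have h1 : 1 ≤ ‖y - z‖ ^ γ := Real.one_le_rpow hyz hγ0.le
      calc ‖χ z • u₀ z‖ = |χ z| * ‖u₀ z‖ := by rw [norm_smul, Real.norm_eq_abs]
        _ ≤ 1 * M := mul_le_mul (hχ1 z) (hM z (ball_subset_ball (by norm_num) hz)) (norm_nonneg _) zero_le_one
        _ = M * 1 * 1 := by ring
        _ ≤ M * (1 + 4 * L) * ‖y - z‖ ^ γ := by gcongr; linarith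
    · rw [hχs z hz, zero_smul, norm_zero]
      positivity
  by_cases hy : y ∈ ball x₀ 2
  · by_cases hz : z ∈ ball x₀ 2
    · -- both inside `B₂(x₀)`
      have hyz : ‖y - z‖ < 4 := by
        rw [mem_ball, dist_eq_norm] at hy hz
        calc ‖y - z‖ = ‖(y - x₀) - (z - x₀)‖ := by abel_nf
          _ ≤ ‖y - x₀‖ + ‖z - x₀‖ := norm_sub_le _ _
          _ < 4 := by linarith
      have hpow : ‖y - z‖ ≤ 4 * ‖y - z‖ ^ γ := by
        rcases eq_or_lt_of_le (norm_nonneg (y - z)) with h0 | hpos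
        · rw [← h0]; positivity
        · have h1 : ‖y - z‖ ^ (1 - γ) ≤ (4 : ℝ) ^ (1 - γ) :=
            Real.rpow_le_rpow (norm_nonneg _) hyz.le (by linarith)
          have h2 : (4 : ℝ) ^ (1 - γ) ≤ 4 := by
            calc (4 : ℝ) ^ (1 - γ) ≤ (4 : ℝ) ^ (1 : ℝ) := Real.rpow_le_rpow_of_exponent_le (by norm_num) (by linarith)
              _ = 4 := Real.rpow_one _
          calc ‖y - z‖ = ‖y - z‖ ^ (1 - γ) * ‖y - z‖ ^ γ := by
                rw [← Real.rpow_add hpos]; norm_num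
            _ ≤ 4 * ‖y - z‖ ^ γ := by gcongr; exact h1.trans h2
      calc ‖χ y • u₀ y - χ z • u₀ z‖ = ‖χ y • (u₀ y - u₀ z) + (χ y - χ z) • u₀ z‖ := by
            congr 1; simp only [smul_sub, sub_smul]; abel
        _ ≤ ‖χ y • (u₀ y - u₀ z)‖ + ‖(χ y - χ z) • u₀ z‖ := norm_add_le _ _
        _ = |χ y| * ‖u₀ y - u₀ z‖ + |χ y - χ z| * ‖u₀ z‖ := by rw [norm_smul, norm_smul, Real.norm_eq_abs, Real.norm_eq_abs]
        _ ≤ 1 * (M * ‖y - z‖ ^ γ) + L * ‖y - z‖ * M := by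
            gcongr
            · exact hχ1 y
            · exact hH y hy z hz
            · exact hχL y z
            · exact hM z hz
        _ ≤ 1 * (M * ‖y - z‖ ^ γ) + L * (4 * ‖y - z‖ ^ γ) * M := by gcongr
        _ = M * (1 + 4 * L) * ‖y - z‖ ^ γ := by ring
    · have h := hout z y hz
      rwa [norm_sub_rev, norm_sub_rev z y] at h
  · exact hout y z hy

/-- The localised datum is bounded by `M`. [folklore] -/
theorem norm_cutoff_smul_le {u₀ : (EuclideanSpace ℝ (Fin 3)) → (EuclideanSpace ℝ (Fin 3))} {χ : (EuclideanSpace ℝ (Fin 3)) → ℝ}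
    {x₀ : EuclideanSpace ℝ (Fin 3)} {M : ℝ} (hM0 : 0 ≤ M) (hM : ∀ x ∈ ball x₀ 2, ‖u₀ x‖ ≤ M)
    (hχ1 : ∀ x, |χ x| ≤ 1) (hχs : ∀ x, x ∉ ball x₀ 1 → χ x = 0) (y : EuclideanSpace ℝ (Fin 3)) :
    ‖χ y • u₀ y‖ ≤ M := by
  by_cases hy : y ∈ ball x₀ 1
  · rw [norm_smul, Real.norm_eq_abs]
    calc |χ y| * ‖u₀ y‖ ≤ 1 * M := mul_le_mul (hχ1 y) (hM y (ball_subset_ball (by norm_num) hy)) (norm_nonneg _) zero_le_one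
      _ = M := one_mul _
  · rw [hχs y hy, zero_smul, norm_zero]; exact hM0

/-- The localised datum is continuous (it is continuous on `B₂(x₀)`, being a product of
continuous functions there, and vanishes on the open set `(B̄₁(x₀))ᶜ`). [folklore] -/
theorem continuous_cutoff_smul {u₀ : (EuclideanSpace ℝ (Fin 3)) → (EuclideanSpace ℝ (Fin 3))} {χ : (EuclideanSpace ℝ (Fin 3)) → ℝ}
    {x₀ : EuclideanSpace ℝ (Fin 3)} (hχ : Continuous χ) (hu₀ : ContinuousOn u₀ (ball x₀ 2))
    (hχs : ∀ x, x ∉ ball x₀ 1 → χ x = 0) : Continuous fun y => χ y • u₀ y := by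
  rw [continuous_iff_continuousAt]
  intro y
  by_cases hy : y ∈ ball x₀ 2
  · exact ((hχ.continuousOn.smul hu₀).continuousAt (isOpen_ball.mem_nhds hy))
  · -- near `y` the function vanishes
    have hy1 : y ∈ (closedBall x₀ 1)ᶜ := fun h => hy (closedBall_subset_ball (by norm_num) h)
    have hev : (fun y' => χ y' • u₀ y') =ᶠ[𝓝 y] fun _ => 0 := by
      filter_upwards [isOpen_compl_iff.2 isClosed_closedBall |>.mem_nhds hy1] with y' hy'
      rw [hχs y' fun h => hy' (ball_subset_closedBall h), zero_smul]
    exact (continuousAt_const.congr hev.symm)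

end JiaSverak2014

end Literature.Analysis.FluidPDE

end
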